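import Summits.ABC.ABC.Theses.IneffectiveSubspace
import Summits.ABC.ABC.Theorems.TowerFourSubLiouville.Negative.Framing

/-!
# Sketch — crux stmt-ABC-14937 `UniformSadicTowerFour` (route-ABC-IneffectiveSubspace), crux-ideate round 1, ideator 2

First-lemma signatures (and the cheap proofs) for the two idea cards of this seat:

* card `factorial-depth-growth` (lever, K-direction): the crux follows from abc-on-{ω₅ ≤ k} with
  constants growing at most like `(k!)^{1+ε}` (`FactorialDepthABC → UniformSadicTowerFour`,
  `uniformSadicTowerFour_of_factorialDepthABC`, the line's main stub), and the whole route sits on ONE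
  growth axis `K ↦ C*(K,ε)`:  `(K!)^{ε}`-growth ⟹ `ABC` (`abc_of_epsGrowthDepthABC`) ⟹
  `FactorialDepthABC` (`factorialDepthABC_of_abc`) ⟹ crux ⟹ `DepthCountedABC`
  (`depthCountedABC_of_factorialDepthABC` closes the square with the route support
  `TowerFourGivesDepthCounted`).
* card `fourth-root-defect-map` (map, K = 0 face): `CruxAtZero` (= the crux at `K = 0`, `S = ∅`,
  PROVED below from the crux), its arithmetic normal form `FourthRootABC` (abc with
  `rad₄(n) = ∏ p^⌈v_p(n)/4⌉`), the defect inequality `c² ≲ a·E` with `E = Π⁴/(abc)` the height of the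
  Fermat-quartic twist, and the landable stratum (bounded twist AND bounded small summand, from the
  in-tree `roth`).
-/

namespace Summit.ABC.ABC.Cruxes.UniformSadicTowerFour.SketchIdeator2

open scoped BigOperators
open Summit.ABC.ABC.Theses.IneffectiveSubspace
open Literature.NumberTheory.DiophantineGeometry (IsABCTriple rad rad_def roth)

/-! ## Vocabulary -/

/-- The 5-depth count `ω₅(n) = #{p : p⁵ ∣ n}` — syntactically the expression used in the route item
`DepthCountedABC` (stmt-ABC-14938). -/
def depthCount (n : ℕ) : ℕ :=
  (n.primeFactors.filter (fun p => 5 ≤ n.factorization p)).card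

/-- The level-4 radical `rad₄(n) = ∏_{p ∣ n} p^{⌈v_p(n)/4⌉}` (`⌈v/4⌉ = (v+3)/4` in `ℕ`); it is
`min {∏ xᵢ : x₁x₂²x₃³x₄⁴ = n}` (optimal lift) and the least `r` with `n ∣ r⁴`. -/
def rad4 (n : ℕ) : ℕ :=
  ∏ p ∈ n.primeFactors, p ^ ((n.factorization p + 3) / 4)

/-! ## Card A — the growth axis `K ↦ C*(K, ε)` -/

/-- `DepthGrowthABC θ`: abc holds with a constant `A(ε) · (ω₅(abc)!)^{θ ε}` — one K-free statement
per growth exponent `θ`.  `θ = fun _ => 0` is `ABC`; `θ = id` (i.e. `(k!)^ε`) still gives `ABC`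
(`abc_of_epsGrowthDepthABC`); `θ = fun ε => 1 + ε` is `FactorialDepthABC`, which gives the crux. -/
def DepthGrowthABC (θ : ℝ → ℝ) : Prop :=
  ∀ ε : ℝ, 0 < ε → ∃ A : ℝ, 0 < A ∧ ∀ a b c : ℕ, IsABCTriple a b c →
    (c : ℝ) < A * ((Nat.factorial (depthCount (a * b * c)) : ℕ) : ℝ) ^ (θ ε) *
      ((rad a b c : ℕ) : ℝ) ^ (1 + ε)

/-- **FactorialDepthABC** (the transfer `C⁺` of card A): for every `ε > 0` there is `A(ε)` with
`c < A · (ω₅(abc)!)^{1+ε} · rad(abc)^{1+ε}` for every abc triple. Implied by `ABC`; implies the crux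
(all `K` at once) and `DepthCountedABC` with `C(K,ε) = A(ε)(K!)^{1+ε}`. -/
def FactorialDepthABC : Prop :=
  DepthGrowthABC (fun ε => 1 + ε)

/-- `ABC → FactorialDepthABC` (the transfer is not stronger than the summit): `(k!)^{1+ε} ≥ 1`. -/
theorem factorialDepthABC_of_abc (habc : ABC) : FactorialDepthABC := by
  intro ε hε
  obtain ⟨C, hC, hmain⟩ := (ABC_iff.mp habc) ε hε
  refine ⟨C, hC, fun a b c h => ?_⟩
  have h1 : (1 : ℝ) ≤ ((Nat.factorial (depthCount (a * b * c)) : ℕ) : ℝ) ^ (1 + ε) :=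
    Real.one_le_rpow (by exact_mod_cast Nat.factorial_pos _) (by linarith)
  have h2 : (0 : ℝ) ≤ ((rad a b c : ℕ) : ℝ) ^ (1 + ε) := Real.rpow_nonneg (by positivity) _
  calc (c : ℝ) < C * ((rad a b c : ℕ) : ℝ) ^ (1 + ε) := hmain a b c h
    _ = C * 1 * ((rad a b c : ℕ) : ℝ) ^ (1 + ε) := by ring
    _ ≤ C * ((Nat.factorial (depthCount (a * b * c)) : ℕ) : ℝ) ^ (1 + ε) *
          ((rad a b c : ℕ) : ℝ) ^ (1 + ε) := by
        apply mul_le_mul_of_nonneg_right _ h2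
        exact mul_le_mul_of_nonneg_left h1 hC.le

/-- `FactorialDepthABC → DepthCountedABC` with the explicit constant `C(K,ε) = A(ε)·(K!)^{1+ε}`
(closes the square with the route support `TowerFourGivesDepthCounted`: crux ⟹ #5). -/
theorem depthCountedABC_of_factorialDepthABC (h : FactorialDepthABC) : DepthCountedABC := by
  intro K ε hε
  obtain ⟨A, hA, hmain⟩ := h ε hε
  refine ⟨A * ((Nat.factorial K : ℕ) : ℝ) ^ (1 + ε), by positivity, fun a b c habc hK => ?_⟩
  have hk : depthCount (a * b * c) ≤ K := hK
  have hfac : ((Nat.factorial (depthCount (a * b * c)) : ℕ) : ℝ) ≤ ((Nat.factorial K : ℕ) : ℝ) := by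
    exact_mod_cast Nat.factorial_le hk
  have hpow : ((Nat.factorial (depthCount (a * b * c)) : ℕ) : ℝ) ^ (1 + ε) ≤
      ((Nat.factorial K : ℕ) : ℝ) ^ (1 + ε) :=
    Real.rpow_le_rpow (by positivity) hfac (by linarith)
  have h2 : (0 : ℝ) ≤ ((rad a b c : ℕ) : ℝ) ^ (1 + ε) := Real.rpow_nonneg (by positivity) _
  calc (c : ℝ) < A * ((Nat.factorial (depthCount (a * b * c)) : ℕ) : ℝ) ^ (1 + ε) *
          ((rad a b c : ℕ) : ℝ) ^ (1 + ε) := hmain a b c habc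
    _ ≤ A * ((Nat.factorial K : ℕ) : ℝ) ^ (1 + ε) * ((rad a b c : ℕ) : ℝ) ^ (1 + ε) := by
        apply mul_le_mul_of_nonneg_right _ h2
        exact mul_le_mul_of_nonneg_left hpow hA.le

/-! ### Proof of the main lemma of card A -/

/-- A finset of `k` positive naturals has product at least `k!` (the `i`-th smallest element is
`≥ i`). Used with `s = primeFactors`: `rad(abc) ≥ ω(abc)! ≥ ω₅(abc)!`. -/
theorem factorial_card_le_prod (s : Finset ℕ) (hs : ∀ p ∈ s, 0 < p) :
    Nat.factorial s.card ≤ ∏ p ∈ s, p := by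
  induction' h : s.card with k ih generalizing s
  · simp [Finset.card_eq_zero.mp h]
  · have hne : s.Nonempty := Finset.card_pos.mp (by omega)
    set M := s.max' hne with hM
    have hMs : M ∈ s := Finset.max'_mem s hne
    have hcard : (s.erase M).card = k := by rw [Finset.card_erase_of_mem hMs]; omega
    have ih' := ih (s.erase M) (fun p hp => hs p (Finset.mem_of_mem_erase hp)) hcard
    -- M ≥ card s: s ⊆ [1, M]
    have hsub : s ⊆ Finset.Icc 1 M := by
      intro p hp
      rw [Finset.mem_Icc]
      exact ⟨hs p hp, Finset.le_max' s p hp⟩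
    have hMge : k + 1 ≤ M := by
      have := Finset.card_le_card hsub
      simp at this; omega
    have hsplit : M * ∏ p ∈ s.erase M, p = ∏ p ∈ s, p := by
      simpa using Finset.mul_prod_erase s (fun p => p) hMs
    rw [← hsplit]
    calc Nat.factorial (k + 1) = (k + 1) * Nat.factorial k := Nat.factorial_succ k
      _ ≤ M * ∏ p ∈ s.erase M, p := Nat.mul_le_mul hMge ih'

/-- `ω₅(abc)! ≤ rad(abc)` for positive `a, b, c`. -/
theorem factorial_depthCount_le_rad {a b c : ℕ} (ha : 0 < a) (hb : 0 < b) (hc : 0 < c) :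
    Nat.factorial (depthCount (a * b * c)) ≤ rad a b c := by
  have hn : a * b * c ≠ 0 := by positivity
  have h1 : Nat.factorial (depthCount (a * b * c)) ≤ Nat.factorial (a * b * c).primeFactors.card :=
    Nat.factorial_le (Finset.card_filter_le _ _)
  have h2 : Nat.factorial (a * b * c).primeFactors.card ≤ ∏ p ∈ (a * b * c).primeFactors, p :=
    factorial_card_le_prod _ (fun p hp => (Nat.prime_of_mem_primeFactors hp).pos)
  have h3 : ∏ p ∈ (a * b * c).primeFactors, p = rad a b c := by
    rw [rad_def, Nat.radical_eq_prod_primeFactors]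
  omega


/-- `B^(j-B) ≤ j!`. -/
theorem pow_sub_le_factorial (B j : ℕ) : B ^ (j - B) ≤ Nat.factorial j := by
  induction' j with n ih
  · simp
  · rcases Nat.lt_or_ge n B with h | h
    · have h0 : n + 1 - B = 0 := by omega
      rw [h0, pow_zero]; exact Nat.factorial_pos _
    · have h1 : n + 1 - B = (n - B) + 1 := by omega
      rw [h1, pow_succ, Nat.factorial_succ]
      calc B ^ (n - B) * B ≤ Nat.factorial n * (n + 1) := Nat.mul_le_mul ih (by omega)
        _ = (n + 1) * Nat.factorial n := by ring

/-- Polynomial versus a power of the factorial: `(j+K)^K ≤ M(K,δ) · (j!)^δ` for all `j`. -/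
theorem exists_pow_le_mul_factorial_rpow (K : ℕ) {δ : ℝ} (hδ : 0 < δ) :
    ∃ M : ℝ, 0 < M ∧ ∀ j : ℕ, ((j + K : ℕ) : ℝ) ^ K ≤ M * ((Nat.factorial j : ℕ) : ℝ) ^ δ := by
  set T : ℝ := (2 : ℝ) ^ K with hT
  have hT0 : 0 < T := by positivity
  have hT1 : 1 ≤ T := one_le_pow₀ (by norm_num)
  -- a base `B` with `T ≤ B^δ`
  obtain ⟨B, hB⟩ : ∃ B : ℕ, T ≤ (B : ℝ) ^ δ := by
    refine ⟨⌈T ^ (1 / δ)⌉₊ + 1, ?_⟩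
    have h0 : (0 : ℝ) ≤ T ^ (1 / δ) := by positivity
    have h1 : T ^ (1 / δ) ≤ ((⌈T ^ (1 / δ)⌉₊ + 1 : ℕ) : ℝ) := by
      push_cast
      exact (Nat.le_ceil _).trans (by linarith)
    calc T = (T ^ (1 / δ)) ^ δ := by
          rw [← Real.rpow_mul hT0.le, one_div_mul_cancel hδ.ne', Real.rpow_one]
      _ ≤ _ := Real.rpow_le_rpow h0 h1 hδ.le
  refine ⟨T ^ K * T ^ B, by positivity, fun j => ?_⟩
  have hfac1 : (1 : ℝ) ≤ ((Nat.factorial j : ℕ) : ℝ) := by exact_mod_cast Nat.factorial_pos j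
  have hfacδ : (1 : ℝ) ≤ ((Nat.factorial j : ℕ) : ℝ) ^ δ := Real.one_le_rpow hfac1 hδ.le
  -- step 1: (j+K)^K ≤ T^(j+K) = T^K * T^j
  have h1 : ((j + K : ℕ) : ℝ) ^ K ≤ T ^ K * T ^ j := by
    have hjk : ((j + K : ℕ) : ℝ) ≤ (2 : ℝ) ^ (j + K) := by
      exact_mod_cast (Nat.lt_two_pow_self).le
    calc ((j + K : ℕ) : ℝ) ^ K ≤ ((2 : ℝ) ^ (j + K)) ^ K := pow_le_pow_left₀ (by positivity) hjk K
      _ = T ^ K * T ^ j := by rw [hT, ← pow_mul, ← pow_mul, ← pow_mul, ← pow_add]; ring_nf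
  -- step 2: T^j ≤ T^B * (j!)^δ
  have h2 : T ^ j ≤ T ^ B * ((Nat.factorial j : ℕ) : ℝ) ^ δ := by
    rcases le_or_gt j B with hjB | hBj
    · calc T ^ j ≤ T ^ B := pow_le_pow_right₀ hT1 hjB
        _ ≤ T ^ B * ((Nat.factorial j : ℕ) : ℝ) ^ δ := le_mul_of_one_le_right (by positivity) hfacδ
    · have hsplit : T ^ j = T ^ B * T ^ (j - B) := by
        rw [← pow_add, Nat.add_sub_cancel' hBj.le]
      rw [hsplit]
      apply mul_le_mul_of_nonneg_left _ (by positivity)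
      have hB0 : (0 : ℝ) ≤ (B : ℝ) := by positivity
      calc T ^ (j - B) ≤ ((B : ℝ) ^ δ) ^ (j - B) := pow_le_pow_left₀ hT0.le hB _
        _ = (((B ^ (j - B) : ℕ)) : ℝ) ^ δ := by
            rw [← Real.rpow_natCast, ← Real.rpow_mul hB0, mul_comm, Real.rpow_mul hB0,
              Real.rpow_natCast]
            push_cast; rfl
        _ ≤ ((Nat.factorial j : ℕ) : ℝ) ^ δ := by
            apply Real.rpow_le_rpow (by positivity) _ hδ.le
            exact_mod_cast pow_sub_le_factorial B j
  calc ((j + K : ℕ) : ℝ) ^ K ≤ T ^ K * T ^ j := h1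
    _ ≤ T ^ K * (T ^ B * ((Nat.factorial j : ℕ) : ℝ) ^ δ) := mul_le_mul_of_nonneg_left h2 (by positivity)
    _ = T ^ K * T ^ B * ((Nat.factorial j : ℕ) : ℝ) ^ δ := by ring

/-- **S-adic charge, arithmetic core.** For `n ∣ m⁴` (both nonzero) and a finite set `S` of primes:
`rad(n) · (#(D(n) ∖ S))! ≤ (∏_{p∈S} p) · ∏_{p ∣ m, p ∉ S} p^{v_p(m)}`, where
`D(n) = {p : v_p(n) ≥ 5}`: deep primes of `n` off `S` have `v_p(m) ≥ 2` and so pay `p · p`. -/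
theorem sadic_charge_lower_bound {n m : ℕ} (hn : n ≠ 0) (hm : m ≠ 0) (hdvd : n ∣ m ^ 4)
    (S : Finset ℕ) (hS : ∀ p ∈ S, Nat.Prime p) :
    UniqueFactorizationMonoid.radical n *
        Nat.factorial ((n.primeFactors.filter (fun p => 5 ≤ n.factorization p)) \ S).card ≤
      (∏ p ∈ S, p) * ∏ p ∈ m.primeFactors \ S, p ^ m.factorization p := by
  set T := m.primeFactors \ S with hTdef
  set D := n.primeFactors.filter (fun p => 5 ≤ n.factorization p) with hDdef
  have hm4 : m ^ 4 ≠ 0 := pow_ne_zero 4 hm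
  have hpf : n.primeFactors ⊆ m.primeFactors := by
    have := Nat.primeFactors_mono hdvd hm4
    rwa [Nat.primeFactors_pow _ (by norm_num)] at this
  have hval : ∀ p, n.factorization p ≤ 4 * m.factorization p := by
    intro p
    have h := (Nat.factorization_le_iff_dvd hn hm4).mpr hdvd p
    simpa [Nat.factorization_pow] using h
  -- (1) ∏_T p^{v_p} ≥ (∏_T p) * ∏_{T, v ≥ 2} p
  have h1 : (∏ p ∈ T, p) * ∏ p ∈ T.filter (fun p => 2 ≤ m.factorization p), p ≤
      ∏ p ∈ T, p ^ m.factorization p := by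
    have hTpos : ∀ p ∈ T, 0 < m.factorization p := by
      intro p hp
      have hp' : p ∈ m.primeFactors := (Finset.mem_sdiff.mp hp).1
      rw [← Nat.support_factorization, Finsupp.mem_support_iff] at hp'
      omega
    have hsplit : ∏ p ∈ T, p ^ m.factorization p = (∏ p ∈ T, p) * ∏ p ∈ T, p ^ (m.factorization p - 1) := by
      rw [← Finset.prod_mul_distrib]
      refine Finset.prod_congr rfl fun p hp => ?_
      conv_lhs => rw [show m.factorization p = (m.factorization p - 1) + 1 by have := hTpos p hp; omega]
      ring
    rw [hsplit]
    apply Nat.mul_le_mul_left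
    calc ∏ p ∈ T.filter (fun p => 2 ≤ m.factorization p), p
        ≤ ∏ p ∈ T.filter (fun p => 2 ≤ m.factorization p), p ^ (m.factorization p - 1) := by
          apply Finset.prod_le_prod (fun p _ => Nat.zero_le _) fun p hp => ?_
          have h2 := (Finset.mem_filter.mp hp).2
          calc p = p ^ 1 := (pow_one p).symm
            _ ≤ p ^ (m.factorization p - 1) := by
                apply Nat.pow_le_pow_right _ (by omega)
                exact (Nat.prime_of_mem_primeFactors (Finset.mem_sdiff.mp (Finset.mem_filter.mp hp).1).1).pos
      _ ≤ ∏ p ∈ T, p ^ (m.factorization p - 1) := by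
          apply Finset.prod_le_prod_of_subset_of_one_le' (Finset.filter_subset _ _)
          intro p hp _
          exact Nat.one_le_pow _ _ (Nat.prime_of_mem_primeFactors (Finset.mem_sdiff.mp hp).1).pos
  -- (2) (∏_S p) * ∏_T p ≥ rad n
  have h2 : UniqueFactorizationMonoid.radical n ≤ (∏ p ∈ S, p) * ∏ p ∈ T, p := by
    rw [Nat.radical_eq_prod_primeFactors]
    have hdisj : Disjoint S T := Finset.disjoint_sdiff
    rw [← Finset.prod_union hdisj]
    apply Finset.prod_le_prod_of_subset_of_one_le'
    · intro p hp
      have hp' := hpf hp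
      rw [Finset.mem_union]
      by_cases hpS : p ∈ S
      · exact Or.inl hpS
      · exact Or.inr (Finset.mem_sdiff.mpr ⟨hp', hpS⟩)
    · intro p hp _
      rcases Finset.mem_union.mp hp with h | h
      · exact (hS p h).pos
      · exact (Nat.prime_of_mem_primeFactors (Finset.mem_sdiff.mp h).1).pos
  -- (3) ∏_{T, v ≥ 2} p ≥ ∏_{D \ S} p ≥ (#(D \ S))!
  have h3 : Nat.factorial (D \ S).card ≤ ∏ p ∈ T.filter (fun p => 2 ≤ m.factorization p), p := by
    calc Nat.factorial (D \ S).card ≤ ∏ p ∈ D \ S, p :=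
          factorial_card_le_prod _ fun p hp =>
            (Nat.prime_of_mem_primeFactors (Finset.mem_filter.mp (Finset.mem_sdiff.mp hp).1).1).pos
      _ ≤ ∏ p ∈ T.filter (fun p => 2 ≤ m.factorization p), p := by
          apply Finset.prod_le_prod_of_subset_of_one_le'
          · intro p hp
            obtain ⟨hpD, hpS⟩ := Finset.mem_sdiff.mp hp
            obtain ⟨hpn, hp5⟩ := Finset.mem_filter.mp hpD
            refine Finset.mem_filter.mpr ⟨Finset.mem_sdiff.mpr ⟨hpf hpn, hpS⟩, ?_⟩
            have := hval p
            omega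
          · intro p hp _
            exact (Nat.prime_of_mem_primeFactors (Finset.mem_sdiff.mp (Finset.mem_filter.mp hp).1).1).pos
  calc UniqueFactorizationMonoid.radical n * Nat.factorial (D \ S).card
      ≤ ((∏ p ∈ S, p) * ∏ p ∈ T, p) * ∏ p ∈ T.filter (fun p => 2 ≤ m.factorization p), p :=
        Nat.mul_le_mul h2 h3
    _ = (∏ p ∈ S, p) * ((∏ p ∈ T, p) * ∏ p ∈ T.filter (fun p => 2 ≤ m.factorization p), p) := by ring
    _ ≤ (∏ p ∈ S, p) * ∏ p ∈ T, p ^ m.factorization p := Nat.mul_le_mul_left _ h1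

/-- `abc ∣ (∏ xᵢyᵢzᵢ)⁴` for a level-4 tower point. -/
theorem abc_dvd_towerProd_pow_four (x y z : Fin 4 → ℕ) :
    (∏ i, x i ^ (i.val + 1)) * (∏ i, y i ^ (i.val + 1)) * (∏ i, z i ^ (i.val + 1)) ∣
      (∏ i, x i * y i * z i) ^ 4 := by
  have hprod : (∏ i, x i ^ (i.val + 1)) * (∏ i, y i ^ (i.val + 1)) * (∏ i, z i ^ (i.val + 1)) =
      ∏ i, (x i * y i * z i) ^ (i.val + 1) := by
    rw [← Finset.prod_mul_distrib, ← Finset.prod_mul_distrib]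
    refine Finset.prod_congr rfl fun i _ => ?_
    ring
  rw [hprod, ← Finset.prod_pow]
  exact Finset.prod_dvd_prod_of_dvd _ _ fun i _ => pow_dvd_pow _ (by have := i.isLt; omega)

/-- The main lemma, hypothesis-first form. -/
theorem main_of_factorialDepthABC (hF : FactorialDepthABC) : UniformSadicTowerFour := by
  intro K ε hε
  obtain ⟨A, hA, hmain⟩ := hF (ε / 2) (by linarith)
  obtain ⟨M, hM, hMj⟩ := exists_pow_le_mul_factorial_rpow K hε
  refine ⟨A * M, by positivity, ?_⟩
  intro S hSK hSp x y z hpos heq hcop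
  set a := ∏ i, x i ^ (i.val + 1) with ha
  set b := ∏ i, y i ^ (i.val + 1) with hb
  set c := ∏ i, z i ^ (i.val + 1) with hc
  set m := ∏ i, x i * y i * z i with hm
  have ha0 : 0 < a := Finset.prod_pos fun i _ => pow_pos (hpos i).1 _
  have hb0 : 0 < b := Finset.prod_pos fun i _ => pow_pos (hpos i).2.1 _
  have hc0 : 0 < c := Finset.prod_pos fun i _ => pow_pos (hpos i).2.2 _
  have hm0 : 0 < m :=
    Finset.prod_pos fun i _ => Nat.mul_pos (Nat.mul_pos (hpos i).1 (hpos i).2.1) (hpos i).2.2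
  have habc : IsABCTriple a b c := ⟨ha0, hb0, heq, hcop⟩
  have hn0 : a * b * c ≠ 0 := by positivity
  have hdvd : a * b * c ∣ m ^ 4 := abc_dvd_towerProd_pow_four x y z
  -- the arithmetic core
  set D := (a * b * c).primeFactors.filter (fun p => 5 ≤ (a * b * c).factorization p) with hD
  set j := (D \ S).card with hj
  have hR : rad a b c * Nat.factorial j ≤ (∏ p ∈ S, p) * ∏ p ∈ m.primeFactors \ S, p ^ m.factorization p := by
    rw [rad_def]
    exact sadic_charge_lower_bound hn0 hm0.ne' hdvd S hSp
  -- depth count k, with j ≤ k ≤ j + K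
  have hkdef : depthCount (a * b * c) = D.card := rfl
  have hjk : j ≤ depthCount (a * b * c) := by
    rw [hkdef]; exact Finset.card_le_card Finset.sdiff_subset
  have hkj : depthCount (a * b * c) ≤ j + K := by
    rw [hkdef]
    calc D.card ≤ (D \ S).card + S.card := Finset.card_le_card_sdiff_add_card
      _ ≤ j + K := by omega
  -- factorial bookkeeping in ℕ
  have hkfac_rad : Nat.factorial (depthCount (a * b * c)) ≤ rad a b c :=
    factorial_depthCount_le_rad ha0 hb0 hc0
  have hkfac_j : Nat.factorial (depthCount (a * b * c)) ≤ Nat.factorial j * (j + K) ^ K := by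
    have h1 : Nat.factorial (depthCount (a * b * c)) ≤ Nat.factorial (j + K) := Nat.factorial_le hkj
    have h2 : Nat.factorial (j + K) = Nat.factorial j * (j + K).descFactorial K := by
      have := Nat.factorial_mul_descFactorial (Nat.le_add_left K j)
      rw [Nat.add_sub_cancel] at this
      exact this.symm
    rw [h2] at h1
    exact h1.trans (Nat.mul_le_mul_left _ (Nat.descFactorial_le_pow _ _))
  -- real side
  have hrad1 : (1 : ℝ) ≤ ((rad a b c : ℕ) : ℝ) := by
    have := Nat.factorial_pos (depthCount (a * b * c))
    exact_mod_cast (show 1 ≤ rad a b c by omega)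
  have hrad0 : (0 : ℝ) < ((rad a b c : ℕ) : ℝ) := by linarith
  set kf : ℝ := ((Nat.factorial (depthCount (a * b * c)) : ℕ) : ℝ) with hkf
  set jf : ℝ := ((Nat.factorial j : ℕ) : ℝ) with hjf
  set R : ℝ := ((rad a b c : ℕ) : ℝ) with hRR
  have hkf0 : 0 < kf := by rw [hkf]; exact_mod_cast Nat.factorial_pos _
  have hjf1 : 1 ≤ jf := by rw [hjf]; exact_mod_cast Nat.factorial_pos _
  have hkfR : kf ≤ R := by rw [hkf, hRR]; exact_mod_cast hkfac_rad
  have hkfj : kf ≤ jf * ((j + K : ℕ) : ℝ) ^ K := by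
    rw [hkf, hjf]; exact_mod_cast hkfac_j
  have hbig : ((rad a b c * Nat.factorial j : ℕ) : ℝ) ≤
      (((∏ p ∈ S, p) * ∏ p ∈ m.primeFactors \ S, p ^ m.factorization p : ℕ) : ℝ) := by
    exact_mod_cast hR
  have step1 : A * kf ^ (1 + ε / 2) * R ^ (1 + ε / 2) ≤ A * kf * R ^ (1 + ε) := by
    have e1 : kf ^ (1 + ε / 2) = kf * kf ^ (ε / 2) := by
      rw [Real.rpow_add hkf0, Real.rpow_one]
    have e2 : R ^ (1 + ε) = R ^ (ε / 2) * R ^ (1 + ε / 2) := by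
      rw [← Real.rpow_add hrad0]; ring_nf
    have hle : kf ^ (ε / 2) ≤ R ^ (ε / 2) := Real.rpow_le_rpow hkf0.le hkfR (by linarith)
    rw [e1, e2]
    have : (0 : ℝ) ≤ R ^ (1 + ε / 2) := Real.rpow_nonneg hrad0.le _
    calc A * (kf * kf ^ (ε / 2)) * R ^ (1 + ε / 2)
        = (A * kf) * (kf ^ (ε / 2) * R ^ (1 + ε / 2)) := by ring
      _ ≤ (A * kf) * (R ^ (ε / 2) * R ^ (1 + ε / 2)) := by
          apply mul_le_mul_of_nonneg_left _ (by positivity)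
          exact mul_le_mul_of_nonneg_right hle this
      _ = A * kf * (R ^ (ε / 2) * R ^ (1 + ε / 2)) := by ring
  have step2 : A * kf * R ^ (1 + ε) ≤ (A * M) * (R * jf) ^ (1 + ε) := by
    have hRpos : (0 : ℝ) ≤ R ^ (1 + ε) := Real.rpow_nonneg hrad0.le _
    have hjK := hMj j
    have e3 : (R * jf) ^ (1 + ε) = R ^ (1 + ε) * (jf * jf ^ ε) := by
      rw [Real.mul_rpow hrad0.le (by linarith)]
      congr 1
      rw [Real.rpow_add (by linarith), Real.rpow_one]
    rw [e3]
    calc A * kf * R ^ (1 + ε) ≤ A * (jf * ((j + K : ℕ) : ℝ) ^ K) * R ^ (1 + ε) := by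
          apply mul_le_mul_of_nonneg_right _ hRpos
          exact mul_le_mul_of_nonneg_left hkfj hA.le
      _ ≤ A * (jf * (M * jf ^ ε)) * R ^ (1 + ε) := by
          apply mul_le_mul_of_nonneg_right _ hRpos
          apply mul_le_mul_of_nonneg_left _ hA.le
          exact mul_le_mul_of_nonneg_left hjK (by linarith)
      _ = (A * M) * (R ^ (1 + ε) * (jf * jf ^ ε)) := by ring
  have step3 : (A * M) * (R * jf) ^ (1 + ε) ≤
      (A * M) * ((((∏ p ∈ S, p) * ∏ p ∈ m.primeFactors \ S, p ^ m.factorization p : ℕ) : ℝ)) ^ (1 + ε) := by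
    apply mul_le_mul_of_nonneg_left _ (by positivity)
    apply Real.rpow_le_rpow (by positivity) _ (by linarith)
    have : R * jf = ((rad a b c * Nat.factorial j : ℕ) : ℝ) := by rw [hRR, hjf]; push_cast; ring
    rw [this]; exact hbig
  have h0 := hmain a b c habc
  calc (c : ℝ) < A * kf ^ (1 + ε / 2) * R ^ (1 + ε / 2) := h0
    _ ≤ A * kf * R ^ (1 + ε) := step1
    _ ≤ (A * M) * (R * jf) ^ (1 + ε) := step2
    _ ≤ (A * M) * ((((∏ p ∈ S, p) * ∏ p ∈ m.primeFactors \ S, p ^ m.factorization p : ℕ) : ℝ)) ^ (1 + ε) := step3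

/-- **First lemma of card A (the line's load-bearing bookkeeping) — PROVED.**
`FactorialDepthABC → UniformSadicTowerFour`.
Proof: fix `K, ε`, take `A` from the hypothesis at `ε/2` and `M` with `(j+K)^K ≤ M (j!)^ε`.
For a tower point with triple `(a,b,c)`, deep set `D = {p : v_p(abc) ≥ 5}`, `k = |D|`, and a set
`S` of `≤ K` primes, put `j = |D ∖ S|` (so `j ≤ k ≤ j + K`). Since `abc ∣ (∏xᵢyᵢzᵢ)⁴`, every deep prime
off `S` has `v_p(∏ xᵢyᵢzᵢ) ≥ 2`, hence `(∏_{p∈S} p)·{∏xᵢyᵢzᵢ}^S ≥ rad(abc) · j!`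
(`sadic_charge_lower_bound`). With `k! ≤ rad(abc)` and `k! ≤ j!·(j+K)^K`:
`A (k!)^{1+ε/2} rad^{1+ε/2} ≤ A·k!·rad^{1+ε} ≤ A·M·(j!)^{1+ε} rad^{1+ε} ≤ (A M)·((∏_S p)·{Π}^S)^{1+ε}`. -/
theorem uniformSadicTowerFour_of_factorialDepthABC :
    FactorialDepthABC → UniformSadicTowerFour :=
  fun hF => main_of_factorialDepthABC hF

/-- **The `ε`-threshold** (route remark under NOT DECOMPOSED YET, made formal): growth `(k!)^{ε}` of
the depth-counted constants already gives `ABC` (with exponent `1 + 2ε`), because `k! ≤ rad(abc)`.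
So on the growth axis: exponent `ε` ⟹ ABC, exponent `1 + ε` ⟹ the crux (card A). -/
theorem abc_of_epsGrowthDepthABC (h : DepthGrowthABC (fun ε => ε)) : ABC := by
  rw [ABC_iff]
  intro ε hε
  obtain ⟨A, hA, hmain⟩ := h (ε / 2) (by linarith)
  refine ⟨A, hA, fun a b c habc => ?_⟩
  obtain ⟨ha, hb, hsum, _⟩ := habc
  have hc : 0 < c := by omega
  have hR1 : (1 : ℝ) ≤ ((rad a b c : ℕ) : ℝ) := by
    have := factorial_depthCount_le_rad ha hb hc
    have hf := Nat.factorial_pos (depthCount (a * b * c))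
    exact_mod_cast (show 1 ≤ rad a b c by omega)
  have hfr : ((Nat.factorial (depthCount (a * b * c)) : ℕ) : ℝ) ≤ ((rad a b c : ℕ) : ℝ) := by
    exact_mod_cast factorial_depthCount_le_rad ha hb hc
  have hstep : ((Nat.factorial (depthCount (a * b * c)) : ℕ) : ℝ) ^ (ε / 2) ≤
      ((rad a b c : ℕ) : ℝ) ^ (ε / 2) :=
    Real.rpow_le_rpow (by positivity) hfr (by linarith)
  have h2 : (0 : ℝ) ≤ ((rad a b c : ℕ) : ℝ) ^ (1 + ε / 2) := Real.rpow_nonneg (by positivity) _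
  calc (c : ℝ) < A * ((Nat.factorial (depthCount (a * b * c)) : ℕ) : ℝ) ^ (ε / 2) *
          ((rad a b c : ℕ) : ℝ) ^ (1 + ε / 2) := hmain a b c ⟨ha, hb, hsum, ‹_›⟩
    _ ≤ A * ((rad a b c : ℕ) : ℝ) ^ (ε / 2) * ((rad a b c : ℕ) : ℝ) ^ (1 + ε / 2) := by
        apply mul_le_mul_of_nonneg_right _ h2
        exact mul_le_mul_of_nonneg_left hstep hA.le
    _ = A * ((rad a b c : ℕ) : ℝ) ^ (1 + ε) := by
        rw [mul_assoc, ← Real.rpow_add (by linarith)]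
        ring_nf

/-! ## Card B — the `K = 0` face: fourth-root abc and the defect normal form -/

/-- The crux at `K = 0`, `S = ∅`: `TowerIneq(4, 1)`, Vojta's inequality with exponent `1` for
`(Γ'_4, D'_4)` at `S = {∞}`. -/
def CruxAtZero : Prop :=
  ∀ ε : ℝ, 0 < ε → ∃ C : ℝ, 0 < C ∧ ∀ x y z : Fin 4 → ℕ, (∀ i, 0 < x i ∧ 0 < y i ∧ 0 < z i) →
    (∏ i, x i ^ (i.val + 1)) + (∏ i, y i ^ (i.val + 1)) = ∏ i, z i ^ (i.val + 1) →
    Nat.Coprime (∏ i, x i ^ (i.val + 1)) (∏ i, y i ^ (i.val + 1)) →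
    ((∏ i, z i ^ (i.val + 1) : ℕ) : ℝ) < C * ((∏ i, x i * y i * z i : ℕ) : ℝ) ^ (1 + ε)

/-- `∏_{p ∣ m} p^{v_p(m)} = m`. -/
theorem prod_primeFactors_pow_factorization {m : ℕ} (hm : m ≠ 0) :
    ∏ p ∈ m.primeFactors, p ^ m.factorization p = m := by
  conv_rhs => rw [← Nat.prod_factorization_pow_eq_self hm]
  rw [Finsupp.prod, Nat.support_factorization]

/-- **The crux contains its `K = 0` face** (take `K = 0`, `S = ∅`; `{m}^∅ = m`). -/
theorem cruxAtZero_of_uniformSadicTowerFour (h : UniformSadicTowerFour) : CruxAtZero := by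
  intro ε hε
  obtain ⟨C, hC, hmain⟩ := h 0 ε hε
  refine ⟨C, hC, fun x y z hpos heq hcop => ?_⟩
  have hm : (∏ i, x i * y i * z i) ≠ 0 :=
    (Finset.prod_pos fun i _ => Nat.mul_pos (Nat.mul_pos (hpos i).1 (hpos i).2.1) (hpos i).2.2).ne'
  have := hmain ∅ (by simp) (by simp) x y z hpos heq hcop
  simpa [prod_primeFactors_pow_factorization hm] using this

/-- **FourthRootABC** — the arithmetic normal form of the `K = 0` face: abc with the radical replaced
by the level-4 radical `rad₄(abc) = ∏ p^{⌈v_p/4⌉}` (`= rad` on 5-free triples). -/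
def FourthRootABC : Prop :=
  ∀ ε : ℝ, 0 < ε → ∃ C : ℝ, 0 < C ∧ ∀ a b c : ℕ, IsABCTriple a b c →
    (c : ℝ) < C * ((rad4 (a * b * c) : ℕ) : ℝ) ^ (1 + ε)

/-- `CruxAtZero ↔ FourthRootABC` (provable now, size M): (→) OPTIMAL lifts `x₄ = ∏ p^{⌈e/4⌉−1+[4∣e]}`,
`x_r = ∏_{e ≡ r (4)} p` give `∏ xᵢ = rad₄(a)` (the route's support TowerFourGivesDepthCounted builds
them); (←) every lift has `rad₄(a) ∣ ∏ xᵢ` (per prime, `min{Σ eᵢ : Σ (i+1)eᵢ = v} = ⌈v/4⌉`,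
sibling triage TRIAGE-r1-1 of stmt-ABC-1649) and `rad₄` is multiplicative on coprime arguments. -/
theorem cruxAtZero_iff_fourthRootABC : CruxAtZero ↔ FourthRootABC := by
  sorry

/-- **Defect normal form of the `K = 0` face.** With `E = (x₀y₀z₀)³(x₁y₁z₁)²(x₂y₂z₂)` (so
`Π⁴ = abc·E`, landed as `Negative.Framing.towerProd_pow_four_eq`; `E = u·v·w` is the height of the
Fermat-quartic twist `vwX⁴ + uwY⁴ = uvZ⁴` carrying the point), the face reads: for coprime positive
points with `a ≤ b`,  `c^{3} < C⁴ · (a·b·E)^{1+ε} · c^{?}` — equivalently (using `c/2 ≤ b < c`)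
`c² ≲ a · E`: the small summand times the twist height controls `c²`.  Stated here in the exact
form that follows from `CruxAtZero` by raising to the 4th power. -/
def DefectIneq : Prop :=
  ∀ ε : ℝ, 0 < ε → ∃ C : ℝ, 0 < C ∧ ∀ x y z : Fin 4 → ℕ, (∀ i, 0 < x i ∧ 0 < y i ∧ 0 < z i) →
    (∏ i, x i ^ (i.val + 1)) + (∏ i, y i ^ (i.val + 1)) = ∏ i, z i ^ (i.val + 1) →
    Nat.Coprime (∏ i, x i ^ (i.val + 1)) (∏ i, y i ^ (i.val + 1)) →
    ((∏ i, z i ^ (i.val + 1) : ℕ) : ℝ) ^ (4 : ℕ) <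
      C * (((∏ i, x i ^ (i.val + 1)) * (∏ i, y i ^ (i.val + 1)) * (∏ i, z i ^ (i.val + 1)) *
        ((x 0 * y 0 * z 0) ^ 3 * (x 1 * y 1 * z 1) ^ 2 * (x 2 * y 2 * z 2)) : ℕ) : ℝ) ^ (1 + ε)

/-- `CruxAtZero ↔ DefectIneq` (provable now, size S: `Π⁴ = abcE` and monotonicity of `t ↦ t⁴`,
`t ↦ t^{1/4}`; constants `C ↦ C⁴`, `ε ↦ ε`). -/
theorem cruxAtZero_iff_defectIneq : CruxAtZero ↔ DefectIneq := by
  sorry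

/-- **Landable stratum of the `K = 0` face (bounded twist AND bounded small summand), from the
in-tree `roth` (PROVED: `roth_holds`).**  For fixed bounds `B` on `a = ∏ xᵢ^{i+1}` and on the twist
height `E`, the tower inequality with exponent `1` holds: each of the finitely many Thue equations
`v·Z⁴ − w·Y⁴ = a·v·w/u'` (fixed binary form, fixed right-hand side) has finitely many coprime
solutions by Thue ⟸ Roth (`|⁴√(w/v) − Z/Y| ≫ Y^{-2-δ}` against `≍ Y^{-4}`), so `c` is bounded on the
stratum.  This is the exponent-`1` analogue of the sibling's landed `stub_fixedFormsRoth`. -/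
theorem cruxAtZero_boundedTwist_boundedA (hroth : roth) (B : ℕ) :
    ∀ ε : ℝ, 0 < ε → ∃ C : ℝ, 0 < C ∧ ∀ x y z : Fin 4 → ℕ, (∀ i, 0 < x i ∧ 0 < y i ∧ 0 < z i) →
    (∏ i, x i ^ (i.val + 1)) + (∏ i, y i ^ (i.val + 1)) = ∏ i, z i ^ (i.val + 1) →
    Nat.Coprime (∏ i, x i ^ (i.val + 1)) (∏ i, y i ^ (i.val + 1)) →
    (∏ i, x i ^ (i.val + 1)) ≤ B →
    (x 0 * y 0 * z 0) ^ 3 * (x 1 * y 1 * z 1) ^ 2 * (x 2 * y 2 * z 2) ≤ B →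
    ((∏ i, z i ^ (i.val + 1) : ℕ) : ℝ) < C * ((∏ i, x i * y i * z i : ℕ) : ℝ) ^ (1 + ε) := by
  sorry

/-- **Sandwich for the map** (what no line may exceed): `ABC → CruxAtZero` is the level-4 case of the
route support `AbcGivesTower` / the sibling's landed `Negative.Framing.towerIneq4_one_of_abc`;
restated here so the card's dictionary is closed under the checker. -/
theorem cruxAtZero_of_abc (habc : ABC) : CruxAtZero :=
  Summit.ABC.ABC.Theorems.TowerFourSubLiouville.Negative.towerIneq4_one_of_abc habc

end Summit.ABC.ABC.Cruxes.UniformSadicTowerFour.SketchIdeator2
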